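import Summits.QuantumFields.YangMills.Theorems.BalabanUVNodesN08HaarCompatibilityGuardUniformWindow
import Literature.Analysis.InnerProduct.KroneckerOperatorNorm

/-!
# BalabanUVNodes ∕ N08 — UNIFORM INJECTIVITY WINDOWS FOR THE PRINTED FIBRE MAP (part 7): ONE radius `r > 0` such that at EVERY guarded fibre
# `(h, W)` the exponential-chart expression `X ↦ K(W·e^X)` is INJECTIVE and `(1 − Σcᵢ)∕(2√N)`-expanding on `{X : Xᴴ = −X, ‖X‖ < r}`

WIDTH SEAT `pub-ymgap-dag-n08-w6` g4 (R399 (3a) second wave; CLAIM-6 ∕ INTENT-7 of record on HOME INBOX; successor of parts 1–6 p616149 · p617624 ·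
p619392 · p620432 · p621515 · p622997 · p624108 (+ part 6 `…GuardUniformWindow`)), 2026-08-28.  Track A, DAG node N08 = [Balaban1985UV3] Thm 1 p. 257
(compact) + Thm 2 p. 272; key item K1⁷ `StabilityBAtRecordR13SepCoPH` (stmt-QuantumFields-20542), `--supports … --as helper`.  COUNT-NEUTRAL.

THE POINT.  The one-window ∕ finitely-many-windows engine frame of sibling n08-w3 (p616325 · p618018 · p620199) needs, for the fibre-law hypothesis
(H_K) ∕ (H_K-core), windows on which the (chart expression of the) printed fibre map `K_W = exp(Σᵢ cᵢ log(hᵢ W*))·W` is INJECTIVE, with a count UNIFORM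
in the frozen holonomies.  This file proves exactly that, at group level and chart-free except for the exponential chart `X ↦ W·e^X` of `U(N)` at `W`:
  ★★★ `uniform_injectivity_windows`: for `cᵢ ≥ 0`, `Σcᵢ < 1`, `δ₀ < 1∕2` there is ONE `r > 0` such that for ALL unitaries `hᵢ, W` with
  `‖hᵢW* − 1‖ ≤ δ₀` the map `X ↦ Kmat h c (W·exp X)` is injective on `{X : Xᴴ = −X, ‖X‖ < r}` and
  `((1 − Σcᵢ)∕(2√|m|))·‖Y − X‖ ≤ ‖K(W e^Y) − K(W e^X)‖` there (`L²`-operator norms).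
MECHANISM ([folklore]).  §2: the window lemma of part 4 with the floor required only on DIFFERENCES of window points (the floor lives on the tangent space,
not on all of `𝕄`): `‖f′(z) − L‖ ≤ ε` on a convex `s` and `λ‖y − x‖ ≤ ‖L(y − x)‖` for `x, y ∈ s` ⟹ `(λ − ε)`-expansion and injectivity — NO coercivity.
§3: `L := D K_W ∘ (W·)` has the floor `λ = (1 − Σcᵢ)∕√|m|` on skew matrices (`floor_op`: g3's sharp Hilbert–Schmidt floor p612264 and §1's comparisons
`‖A‖² ≤ hs(A,A) ≤ |m|·‖A‖²`); the chart derivative is `f′(X₀) = D K_{W e^{X₀}} ∘ (W·) ∘ dexp(X₀)` (`hasFDerivAt_kmat_expChart`, pub-balaban's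
`hasStrictFDerivAt_Kmat` + `hasFDerivAt_exp_dexp`), and `‖f′(X₀) − L‖ ≤ λ∕2` on a ball of radius depending only on `(c, δ₀, |m|)`: part 6's
`uniform_emlD_modulus` (Heine–Cantor on the compact closed guard) bounds `‖D K_{We^{X₀}} − D K_W‖`, `exists_bound_emlD` bounds `‖D K_W‖` uniformly
(compactness), and `dexp`, `exp` are continuous at `0` (`exists_ball_norm_dexp_sub_le`, `exists_norm_exp_sub_one_lt`).  §4 assembles on the convex
window `ball 0 r ∩ {Xᴴ = −X}` (`convex_skewBall`); `exists_skew_exp_eq_of_norm_sub_le` (a unitary at distance `≤ ρ < 1∕2` from `W` IS `W·e^X`,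
`X = log(W*W′)` skew, `‖X‖ ≤ 2ρ`) and `exists_finite_window_cover` (finitely many windows of radius `r` cover `U(N)`, their number depending on `r`
and `N` only — total boundedness of the compact `U(N)`) make the windows genuine neighbourhoods in the group with a fibre-independent count.
HOW IT IS MEANT TO BE USED (located; nothing of the chart frame is typed here): at `N = 2` the window `{W·exp X}` is print's `w₀·exp(iA·σ)`,
`|A| = ‖X‖` (`B10Eq18SigmaSU2Haar.exp_su2Coord`), so injectivity of the chart conjugate on `|A| < r` is this theorem read through the dictionary;
the window count for a cover of `SU(2)` by such windows depends on `r` only — the uniformity (H_K-core) demands.  The radius is EXISTENTIAL (compactness).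

HONEST FRAMING.  Count-neutral [folklore] calculus∕compactness over pub-balaban's `Kmat`∕`emlD`, g3's floor and the cited joint continuity; NO explicit radius,
NO chart composition with print's `σ`-chart, NO Jacobian of the chart, NO density bound typed; (H_K) ∕ (H_K-core) NOT discharged; nothing of Bałaban asserted;
E6′ NOT decided; `hmass` NOT supplied; N08 NOT discharged; counts unmoved (typed 28∕28 · discharged 5∕27); no summit statement is proved by this seat — one
finite 𝕋⁴ programme at fixed ε, R4 closes the CONDITIONAL rung `BalabanLadder.UV` only; the Yang–Mills mass gap (Clay) is NOT proved by any of this; nothing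
continuum ∕ ℝ⁴ ∕ OS.  0 `sorry`, 0 `def`, 0 `instance`, 0 `notation`, standard axioms.
-/

noncomputable section

open Set NormedSpace Filter Metric
open scoped Topology Matrix Matrix.Norms.L2Operator

namespace Summit.QuantumFields.YangMills.BalabanUVNodes.N08HaarCompatibilityGuardInjectivityWindows

open Literature.MathematicalPhysics.QuantumFieldTheory.Balaban1983to89
open Literature.MathematicalPhysics.QuantumFieldTheory.Balaban1983to89.T4EMLTangentInjective
open Literature.MathematicalPhysics.QuantumFieldTheory.Balaban1983to89.T4AdjointCovarianceUnitary (lieU mem_lieU_iff)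
open Summit.QuantumFields.YangMills.BalabanUVNodes.N08HaarCompatibilityGuardJacobianDet (norm_sq_eq_hs)
open Matrix (unitaryGroup)

variable {m : Type*} [Fintype m] [DecidableEq m]

/-! ## §1 [folklore] The Hilbert–Schmidt norm versus the `L²`-operator norm: `‖A‖ ≤ ‖A‖_HS ≤ √|m|·‖A‖` -/

/-- Column `b` of `A` is `A` applied to the `b`-th basis vector: its Euclidean norm is at most `‖A‖`. [folklore] -/
theorem sum_norm_sq_col_le (A : Matrix m m ℂ) (b : m) : ∑ a, ‖A a b‖ ^ 2 ≤ ‖A‖ ^ 2 := by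
  have h := Literature.Analysis.InnerProduct.norm_toLp_mulVec_le A (EuclideanSpace.single b (1 : ℂ))
  rw [EuclideanSpace.single, PiLp.norm_single, norm_one, mul_one] at h
  have e : ∑ a, ‖A a b‖ ^ 2 = ‖(WithLp.toLp 2 (A *ᵥ WithLp.ofLp (EuclideanSpace.single b (1 : ℂ))) : EuclideanSpace ℂ m)‖ ^ 2 := by
    rw [EuclideanSpace.norm_sq_eq]
    refine Finset.sum_congr rfl fun a _ => ?_
    congr 2
    simp [Matrix.mulVec, dotProduct, EuclideanSpace.single]
  rw [e]
  exact pow_le_pow_left₀ (norm_nonneg _) h 2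

/-- **`hs(A, A) ≤ |m|·‖A‖²`** (sum the column bounds). [folklore] -/
theorem hs_self_le_card_mul_sq_norm (A : Matrix m m ℂ) : hs A A ≤ Fintype.card m * ‖A‖ ^ 2 := by
  rw [hs_self, Finset.sum_comm]
  calc ∑ b, ∑ a, ‖A a b‖ ^ 2 ≤ ∑ _b : m, ‖A‖ ^ 2 := Finset.sum_le_sum fun b _ => sum_norm_sq_col_le A b
    _ = Fintype.card m * ‖A‖ ^ 2 := by rw [Finset.sum_const, Finset.card_univ, nsmul_eq_mul]

/-- **`‖A‖ ≤ ‖A‖_HS`**: `‖A‖ ≤ √hs(A, A)` (Cauchy–Schwarz row by row, as an operator-norm bound). [folklore] -/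
theorem norm_le_sqrt_hs_self (A : Matrix m m ℂ) : ‖A‖ ≤ Real.sqrt (hs A A) := by
  have h0 : 0 ≤ hs A A := hs_self_nonneg A
  refine Literature.Analysis.InnerProduct.l2_opNorm_le_of_forall_norm_mulVec_le A (Real.sqrt_nonneg _)
    fun x => ?_
  have hx : ‖x‖ ^ 2 = ∑ j, ‖WithLp.ofLp x j‖ ^ 2 := by rw [EuclideanSpace.norm_sq_eq]
  have hrow : ∀ i, ‖(WithLp.toLp 2 (A *ᵥ WithLp.ofLp x) : EuclideanSpace ℂ m) i‖ ^ 2 ≤ (∑ j, ‖A i j‖ ^ 2) * ∑ j, ‖WithLp.ofLp x j‖ ^ 2 := by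
    intro i
    have e : (WithLp.toLp 2 (A *ᵥ WithLp.ofLp x) : EuclideanSpace ℂ m) i = ∑ j, A i j * WithLp.ofLp x j := by
      simp only [Matrix.mulVec, dotProduct]
    rw [e]
    calc ‖∑ j, A i j * WithLp.ofLp x j‖ ^ 2 ≤ (∑ j, ‖A i j‖ * ‖WithLp.ofLp x j‖) ^ 2 := by
          gcongr; exact (norm_sum_le _ _).trans (le_of_eq (Finset.sum_congr rfl fun j _ => norm_mul _ _))
      _ ≤ (∑ j, ‖A i j‖ ^ 2) * ∑ j, ‖WithLp.ofLp x j‖ ^ 2 := Finset.sum_mul_sq_le_sq_mul_sq _ _ _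
  have hsq : ‖(WithLp.toLp 2 (A *ᵥ WithLp.ofLp x) : EuclideanSpace ℂ m)‖ ^ 2 ≤ (Real.sqrt (hs A A) * ‖x‖) ^ 2 := by
    rw [mul_pow, Real.sq_sqrt h0, EuclideanSpace.norm_sq_eq, hs_self, Finset.sum_mul, hx]
    exact Finset.sum_le_sum fun i _ => hrow i
  exact (pow_le_pow_iff_left₀ (norm_nonneg _) (mul_nonneg (Real.sqrt_nonneg _) (norm_nonneg _)) two_ne_zero).1 hsq

/-- `‖A‖² ≤ hs(A, A)`. [folklore] -/
theorem sq_norm_le_hs_self (A : Matrix m m ℂ) : ‖A‖ ^ 2 ≤ hs A A := by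
  have h := pow_le_pow_left₀ (norm_nonneg A) (norm_le_sqrt_hs_self A) 2
  rwa [Real.sq_sqrt (hs_self_nonneg A)] at h

/-! ## §2 [folklore] The window lemma with the floor only on DIFFERENCES of window points (the floor of this lineage lives on the tangent
space `𝔲(N)`, not on all of `𝕄`) -/

section Window

variable {E F : Type*} [NormedAddCommGroup E] [NormedSpace ℝ E] [NormedAddCommGroup F] [NormedSpace ℝ F]

/-- **Expansion and injectivity on a convex window, floor on differences only**: `f` differentiable within a convex `s`, `‖f′(z) − L‖ ≤ ε` on `s`,
and `λ‖y − x‖ ≤ ‖L(y − x)‖` for `x, y ∈ s`; then `(λ − ε)‖y − x‖ ≤ ‖f y − f x‖` on `s` (part 4's `mul_norm_sub_le_norm_sub`, same proof). [folklore] -/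
theorem mul_norm_sub_le_norm_sub_of_sub {f : E → F} {f' : E → E →L[ℝ] F} {s : Set E} (hs : Convex ℝ s)
    (hf : ∀ z ∈ s, HasFDerivWithinAt f (f' z) s z) (L : E →L[ℝ] F) {l ε : ℝ}
    (hL : ∀ x ∈ s, ∀ y ∈ s, l * ‖y - x‖ ≤ ‖L (y - x)‖) (hε : ∀ z ∈ s, ‖f' z - L‖ ≤ ε) {x y : E} (hx : x ∈ s) (hy : y ∈ s) :
    (l - ε) * ‖y - x‖ ≤ ‖f y - f x‖ := by
  have hmv : ‖f y - f x - L (y - x)‖ ≤ ε * ‖y - x‖ := hs.norm_image_sub_le_of_norm_hasFDerivWithin_le' hf hε hx hy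
  have h1 : l * ‖y - x‖ ≤ ‖L (y - x)‖ := hL x hx y hy
  have h2 : ‖L (y - x)‖ - ‖f y - f x‖ ≤ ‖L (y - x) - (f y - f x)‖ := norm_sub_norm_le _ _
  have h3 : ‖L (y - x) - (f y - f x)‖ = ‖f y - f x - L (y - x)‖ := by rw [← norm_neg]; congr 1; abel
  linarith

/-- **Injectivity** under the same hypotheses with `ε < λ`. [folklore] -/
theorem injOn_of_norm_fderiv_sub_le_of_sub {f : E → F} {f' : E → E →L[ℝ] F} {s : Set E} (hs : Convex ℝ s)
    (hf : ∀ z ∈ s, HasFDerivWithinAt f (f' z) s z) (L : E →L[ℝ] F) {l ε : ℝ}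
    (hL : ∀ x ∈ s, ∀ y ∈ s, l * ‖y - x‖ ≤ ‖L (y - x)‖) (hε : ∀ z ∈ s, ‖f' z - L‖ ≤ ε) (hlε : ε < l) : InjOn f s := by
  intro x hx y hy hxy
  have h := mul_norm_sub_le_norm_sub_of_sub hs hf L hL hε hx hy
  rw [hxy, sub_self, norm_zero] at h
  have h0 : ‖y - x‖ ≤ 0 := by
    by_contra hcon
    push Not at hcon
    have := mul_pos (sub_pos.2 hlε) hcon
    linarith
  exact (sub_eq_zero.1 (norm_le_zero_iff.1 h0)).symm

end Window

/-! ## §3 Calculus of the exponential-chart expression `X ↦ K(W·e^X)` on the skew-Hermitian matrices -/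

section Chart

variable [Nonempty m] {ι : Type*} [Fintype ι]

/-- **`Z ↦ dexp Z` (as a real-linear map) is continuous at `0`**: for every `ε > 0` a radius `ρ > 0` with `‖dexp Z|_ℝ − dexp 0|_ℝ‖ ≤ ε` on the ball
(`dexp` is the Fréchet derivative of the analytic `exp`; part 4's `exists_ball_norm_sub_le`). [folklore] -/
theorem exists_ball_norm_dexp_sub_le {ε : ℝ} (hε : 0 < ε) :
    ∃ ρ > 0, ∀ Z ∈ ball (0 : Matrix m m ℂ) ρ,
      ‖(dexp Z).restrictScalars ℝ - (dexp (0 : Matrix m m ℂ)).restrictScalars ℝ‖ ≤ ε := by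
  have hfd : ∀ Z : Matrix m m ℂ, fderiv ℂ (exp : Matrix m m ℂ → Matrix m m ℂ) Z = dexp Z := fun Z => (hasFDerivAt_exp_dexp Z).fderiv
  have hc : ContinuousAt (fun Z : Matrix m m ℂ => fderiv ℂ (exp : Matrix m m ℂ → Matrix m m ℂ) Z) 0 :=
    (NormedSpace.exp_analytic (𝕂 := ℂ) (0 : Matrix m m ℂ)).contDiffAt.continuousAt_fderiv (n := 1) one_ne_zero
  have hc' : ContinuousAt (fun Z : Matrix m m ℂ => dexp Z) 0 := hc.congr (Eventually.of_forall fun Z => hfd Z)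
  have hR : Continuous fun T : Matrix m m ℂ →L[ℂ] Matrix m m ℂ => T.restrictScalars ℝ :=
    (ContinuousLinearMap.restrictScalarsL ℂ (Matrix m m ℂ) (Matrix m m ℂ) ℝ ℝ).continuous
  have hc'' : ContinuousAt (fun Z : Matrix m m ℂ => (dexp Z).restrictScalars ℝ) 0 := hR.continuousAt.comp hc'
  exact Summit.QuantumFields.YangMills.BalabanUVNodes.N08HaarCompatibilityGuardWindowInjective.exists_ball_norm_sub_le hc'' hε

/-- `dexp 0|_ℝ = id`. [folklore] -/
theorem dexp_zero_restrictScalars : (dexp (0 : Matrix m m ℂ)).restrictScalars ℝ = ContinuousLinearMap.id ℝ (Matrix m m ℂ) :=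
  ContinuousLinearMap.ext fun F => by
    rw [ContinuousLinearMap.coe_restrictScalars', ContinuousLinearMap.id_apply]
    exact Summit.QuantumFields.YangMills.BalabanUVNodes.N08HaarCompatibilityGuardJacobian.dexp_zero_apply F

/-- **`exp` is continuous at `0`**: for every `η > 0` there is `ρ > 0` with `‖exp Z − 1‖ < η` for `‖Z‖ < ρ`. [folklore] -/
theorem exists_norm_exp_sub_one_lt {η : ℝ} (hη : 0 < η) :
    ∃ ρ > 0, ∀ Z : Matrix m m ℂ, ‖Z‖ < ρ → ‖exp Z - 1‖ < η := by
  have hc : ContinuousAt (exp : Matrix m m ℂ → Matrix m m ℂ) 0 := (hasFDerivAt_exp_dexp (0 : Matrix m m ℂ)).continuousAt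
  rcases Metric.continuousAt_iff.1 hc η hη with ⟨ρ, hρ, H⟩
  exact ⟨ρ, hρ, fun Z hZ => by have := H (by rwa [dist_zero_right]); rwa [dist_eq_norm, exp_zero] at this⟩

/-- **A uniform bound for the tangent maps on the closed guard**: `‖emlD h c W‖ ≤ B` for all unitaries `hᵢ, W` with `‖hᵢW* − 1‖ ≤ δ₀ < 1`
(continuity on the compact closed guard, part 6's `isCompact_closedGuard`). [folklore] -/
theorem exists_bound_emlD (c : ι → ℝ) {δ₀ : ℝ} (hδ₀ : δ₀ < 1) :
    ∃ B : ℝ, 0 < B ∧ ∀ (h : ι → Matrix m m ℂ) (W : Matrix m m ℂ), (∀ i, h i ∈ unitaryGroup m ℂ) → W ∈ unitaryGroup m ℂ →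
      (∀ i, ‖h i * star W - 1‖ ≤ δ₀) → ‖emlD h c W‖ ≤ B := by
  have hK := Summit.QuantumFields.YangMills.BalabanUVNodes.N08HaarCompatibilityGuardUniformWindow.isCompact_closedGuard
    (m := m) (ι := ι) δ₀
  have hdom : {p : (ι → Matrix m m ℂ) × Matrix m m ℂ |
      (∀ i, p.1 i ∈ unitaryGroup m ℂ) ∧ p.2 ∈ unitaryGroup m ℂ ∧ ∀ i, ‖p.1 i * star p.2 - 1‖ ≤ δ₀}
      ⊆ {p | ∀ i, ‖p.1 i * star p.2 - 1‖ < 1} := fun p hp i => (hp.2.2 i).trans_lt hδ₀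
  have hcont := (Summit.QuantumFields.YangMills.Theorems.HeightChiSqLEmlDContinuous.continuousOn_emlD (m := m) c).mono hdom
  obtain ⟨B, hB⟩ := hK.exists_bound_of_continuousOn (E := Matrix m m ℂ →L[ℝ] Matrix m m ℂ) hcont
  refine ⟨max B 1, lt_max_of_lt_right one_pos, fun h W hh hW hg => ?_⟩
  exact (hB (h, W) ⟨hh, hW, hg⟩).trans (le_max_left _ _)

/-- **The derivative of the chart expression.**  At `X₀` with `W·e^{X₀}` guarded:
`D[X ↦ K(W·e^X)](X₀) = D K_{W e^{X₀}} ∘ (W·) ∘ dexp(X₀)` (pub-balaban's `hasStrictFDerivAt_Kmat`, `hasFDerivAt_exp_dexp`). [folklore] -/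
theorem hasFDerivAt_kmat_expChart (h : ι → Matrix m m ℂ) (c : ι → ℝ) (W X₀ : Matrix m m ℂ)
    (hg : ∀ i, ‖h i * star (W * exp X₀) - 1‖ < 1) :
    HasFDerivAt (fun X : Matrix m m ℂ => Kmat h c (W * exp X))
      ((emlD h c (W * exp X₀)).comp ((ContinuousLinearMap.mul ℝ (Matrix m m ℂ) W).comp ((dexp X₀).restrictScalars ℝ))) X₀ := by
  have h2 : HasFDerivAt (fun X : Matrix m m ℂ => exp X) ((dexp X₀).restrictScalars ℝ) X₀ := (hasFDerivAt_exp_dexp X₀).restrictScalars ℝ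
  have h3 : HasFDerivAt (fun X : Matrix m m ℂ => W * exp X)
      ((ContinuousLinearMap.mul ℝ (Matrix m m ℂ) W).comp ((dexp X₀).restrictScalars ℝ)) X₀ :=
    (ContinuousLinearMap.mul ℝ (Matrix m m ℂ) W).hasFDerivAt.comp X₀ h2
  exact (hasStrictFDerivAt_Kmat h c hg).hasFDerivAt.comp X₀ h3

/-- **The floor of the tangent map at the centre, in the `L²`-operator norm**: for skew-Hermitian `X`,
`((1 − Σcᵢ)∕√|m|)·‖X‖ ≤ ‖D K_W(W X)‖` — g3's sharp Hilbert–Schmidt floor (p612264) and the two comparisons of §1. [folklore] -/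
theorem floor_op {h : ι → Matrix m m ℂ} (hh : ∀ i, h i ∈ unitaryGroup m ℂ) {W : Matrix m m ℂ} (hWu : W ∈ unitaryGroup m ℂ)
    (hg : ∀ i, ‖h i * star W - 1‖ < 1 / 2) {c : ι → ℝ} (hc0 : ∀ i, 0 ≤ c i) (hc1 : ∑ i, c i ≤ 1) {X : Matrix m m ℂ} (hX : Xᴴ = -X) :
    (1 - ∑ i, c i) / Real.sqrt (Fintype.card m) * ‖X‖ ≤ ‖emlD h c W (W * X)‖ := by
  have hlow := Summit.QuantumFields.YangMills.BalabanUVNodes.N08HaarCompatibilityGuardJacobianSharpNorm.emlD_tangent_lower_bound_sharp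
    hh hWu hg hc0 hc1 X hX
  set E := emlD h c W (W * X)
  have hup := hs_self_le_card_mul_sq_norm E
  have hdn := sq_norm_le_hs_self X
  have hcard : (0 : ℝ) < Fintype.card m := Nat.cast_pos.mpr Fintype.card_pos
  have hsq : 0 < Real.sqrt (Fintype.card m) := Real.sqrt_pos.2 hcard
  have hlam : 0 ≤ 1 - ∑ i, c i := by linarith
  have h1 : ((1 - ∑ i, c i) * ‖X‖) ^ 2 ≤ (Real.sqrt (Fintype.card m) * ‖E‖) ^ 2 := by
    rw [mul_pow, mul_pow, Real.sq_sqrt hcard.le]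
    calc (1 - ∑ i, c i) ^ 2 * ‖X‖ ^ 2 ≤ (1 - ∑ i, c i) ^ 2 * hs X X := mul_le_mul_of_nonneg_left hdn (sq_nonneg _)
      _ ≤ hs E E := hlow
      _ ≤ Fintype.card m * ‖E‖ ^ 2 := hup
  have h2 := (pow_le_pow_iff_left₀ (mul_nonneg hlam (norm_nonneg _)) (mul_nonneg hsq.le (norm_nonneg _)) two_ne_zero).1 h1
  rw [div_mul_eq_mul_div, div_le_iff₀ hsq]
  linarith [mul_comm (Real.sqrt (Fintype.card m)) ‖E‖]

end Chart

/-! ## §4 ★★★ UNIFORM INJECTIVITY WINDOWS -/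

section Main

variable [Nonempty m] {ι : Type*} [Fintype ι]

omit [Nonempty m] in
/-- The window: skew-Hermitian matrices of operator norm `< r` — a convex set (ball ∩ real subspace). [folklore] -/
theorem convex_skewBall (r : ℝ) : Convex ℝ (ball (0 : Matrix m m ℂ) r ∩ {X : Matrix m m ℂ | Xᴴ = -X}) := by
  refine (convex_ball _ _).inter ?_
  have e : {X : Matrix m m ℂ | Xᴴ = -X} = (Literature.MathematicalPhysics.QuantumFieldTheory.Balaban1983to89.T4AdjointCovarianceUnitary.lieU m :
      Set (Matrix m m ℂ)) := by
    ext X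
    rw [Set.mem_setOf_eq, SetLike.mem_coe, mem_lieU_iff, Matrix.star_eq_conjTranspose]
  rw [e]
  exact (Literature.MathematicalPhysics.QuantumFieldTheory.Balaban1983to89.T4AdjointCovarianceUnitary.lieU m).convex

/-- **The windows are neighbourhoods in the group**: a unitary `W′` with `‖W′ − W‖ ≤ ρ < 1∕2` (`W` unitary) IS `W·e^X` with `X = log(W*W′)`
skew-Hermitian and `‖X‖ ≤ 2ρ` (pub-balaban's `exp_mlog`, `star_mlog_of_unitary`, `norm_mlog_le_two_mul`) — so the window `{W·e^X : Xᴴ = −X, ‖X‖ < r}`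
contains the metric ball of radius `min(r∕3, 1∕3)` of `U(N)` around `W`, and a finite net of such balls, of cardinality depending on `r` and `N` only,
covers the compact `U(N)`. [folklore] -/
theorem exists_skew_exp_eq_of_norm_sub_le {W W' : Matrix m m ℂ} (hW : W ∈ unitaryGroup m ℂ) (hW' : W' ∈ unitaryGroup m ℂ) {ρ : ℝ}
    (hρ : ρ < 1 / 2) (hd : ‖W' - W‖ ≤ ρ) :
    ∃ X : Matrix m m ℂ, Xᴴ = -X ∧ ‖X‖ ≤ 2 * ρ ∧ W * exp X = W' := by
  have hW1 : star W * W = 1 := Matrix.mem_unitaryGroup_iff'.mp hW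
  have hW2 : W * star W = 1 := Matrix.mem_unitaryGroup_iff.mp hW
  have hnW : ‖star W‖ = 1 := by rw [norm_star]; exact CStarRing.norm_of_mem_unitary hW
  set P : Matrix m m ℂ := star W * W' with hP
  have hPu : P ∈ unitaryGroup m ℂ := mul_mem (Unitary.star_mem hW) hW'
  have hP1 : ‖P - 1‖ ≤ ρ := by
    have e : P - 1 = star W * (W' - W) := by rw [hP, mul_sub, hW1]
    rw [e]
    calc ‖star W * (W' - W)‖ ≤ ‖star W‖ * ‖W' - W‖ := norm_mul_le _ _
      _ ≤ ρ := by rw [hnW, one_mul]; exact hd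
  have hP1' : ‖P - 1‖ < 1 / 2 := hP1.trans_lt hρ
  have hP1'' : ‖P - 1‖ < 1 := hP1'.trans (by norm_num)
  refine ⟨MatrixLog.mlog P, ?_, ?_, ?_⟩
  · rw [← Matrix.star_eq_conjTranspose]; exact star_mlog_of_unitary hPu hP1'
  · exact (MatrixLog.norm_mlog_le_two_mul hP1'.le).trans (by linarith)
  · rw [MatrixLog.exp_mlog hP1'', hP, ← mul_assoc, hW2, one_mul]

omit [Nonempty m] in
/-- **A finite, fibre-independent cover of `U(N)` by windows of radius `r`**: for every `r > 0` finitely many unitaries `W_k` with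
`U(N) ⊆ ⋃_k W_k·exp{Xᴴ = −X, ‖X‖ < r}` (total boundedness of the compact `U(N)` + `exists_skew_exp_eq_of_norm_sub_le`) — the number of windows a fibre
needs depends on `r` and `N` only. [folklore] -/
theorem exists_finite_window_cover [Nonempty m] {r : ℝ} (hr : 0 < r) :
    ∃ t : Set (Matrix m m ℂ), t.Finite ∧ t ⊆ (unitaryGroup m ℂ : Set (Matrix m m ℂ)) ∧
      ∀ W' ∈ unitaryGroup m ℂ, ∃ W ∈ t, ∃ X : Matrix m m ℂ, Xᴴ = -X ∧ ‖X‖ < r ∧ W * exp X = W' := by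
  set ρ : ℝ := min (r / 4) (1 / 4) with hρdef
  have hρ : 0 < ρ := lt_min (by linarith) (by norm_num)
  obtain ⟨t, hts, htf, hcov⟩ := Metric.finite_approx_of_totallyBounded
    (Literature.NumberTheory.Automorphic.Matrix.isCompact_unitaryGroup (ι := m) (𝕜 := ℂ)).totallyBounded ρ hρ
  refine ⟨t, htf, hts, fun W' hW' => ?_⟩
  obtain ⟨W, hWt, hWball⟩ := Set.mem_iUnion₂.1 (hcov hW')
  have hd : ‖W' - W‖ ≤ ρ := by rw [← dist_eq_norm]; exact (mem_ball.1 hWball).le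
  obtain ⟨X, hX, hXn, hXe⟩ := exists_skew_exp_eq_of_norm_sub_le (hts hWt) hW' (show ρ < 1 / 2 by
    rw [hρdef]; exact (min_le_right _ _).trans_lt (by norm_num)) hd
  exact ⟨W, hWt, X, hX, by
    have : 2 * ρ < r := by rw [hρdef]; linarith [min_le_left (r / 4) (1 / 4)]
    linarith, hXe⟩

/-- ★★★ **UNIFORM INJECTIVITY WINDOWS FOR THE PRINTED FIBRE MAP.**  For weights `cᵢ ≥ 0` with `Σcᵢ < 1` and any `δ₀ < 1∕2` there is ONE
radius `r > 0` such that at EVERY guarded fibre — unitaries `hᵢ, W` with `‖hᵢW* − 1‖ ≤ δ₀` — the exponential-chart expression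
`X ↦ K(W·e^X) = Kmat h c (W·exp X)` of the fibre map is INJECTIVE on the window `{X : Xᴴ = −X, ‖X‖ < r}` and
`((1 − Σcᵢ)∕(2√|m|))`-EXPANDING there (`L²`-operator norms).
PROOF: §2's window lemma (NO coercivity) with `L :=` the derivative at the centre (floor `(1 − Σcᵢ)∕√|m|` on skew differences, `floor_op`); the oscillation
`‖f′(X₀) − L‖ ≤ floor∕2` on a UNIFORM ball from part 6's `uniform_emlD_modulus` (Heine–Cantor on the compact closed guard), `exists_bound_emlD`, and the
continuity of `dexp` and `exp` at `0`. [folklore] -/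
theorem uniform_injectivity_windows (c : ι → ℝ) (hc0 : ∀ i, 0 ≤ c i) (hc1 : ∑ i, c i < 1) {δ₀ : ℝ} (hδ₀ : δ₀ < 1 / 2) :
    ∃ r > 0, ∀ (h : ι → Matrix m m ℂ) (W : Matrix m m ℂ), (∀ i, h i ∈ unitaryGroup m ℂ) → W ∈ unitaryGroup m ℂ →
      (∀ i, ‖h i * star W - 1‖ ≤ δ₀) →
        InjOn (fun X : Matrix m m ℂ => Kmat h c (W * exp X)) (ball (0 : Matrix m m ℂ) r ∩ {X | Xᴴ = -X}) ∧
        ∀ X ∈ ball (0 : Matrix m m ℂ) r ∩ {X : Matrix m m ℂ | Xᴴ = -X}, ∀ Y ∈ ball (0 : Matrix m m ℂ) r ∩ {X : Matrix m m ℂ | Xᴴ = -X},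
          (1 - ∑ i, c i) / (2 * Real.sqrt (Fintype.card m)) * ‖Y - X‖ ≤ ‖Kmat h c (W * exp Y) - Kmat h c (W * exp X)‖ := by
  have hcard : (0 : ℝ) < Fintype.card m := Nat.cast_pos.mpr Fintype.card_pos
  have hsq : 0 < Real.sqrt (Fintype.card m) := Real.sqrt_pos.2 hcard
  set l : ℝ := (1 - ∑ i, c i) / Real.sqrt (Fintype.card m) with hl
  have hl0 : 0 < l := div_pos (by linarith) hsq
  obtain ⟨B, hB0, hB⟩ := exists_bound_emlD (m := m) c (show δ₀ < 1 by linarith)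
  obtain ⟨r₆, hr₆, H₆⟩ := Summit.QuantumFields.YangMills.BalabanUVNodes.N08HaarCompatibilityGuardUniformWindow.uniform_emlD_modulus
    (m := m) c hδ₀ (show 0 < l / 8 by positivity)
  obtain ⟨ρ₂, hρ₂, H₂⟩ := exists_ball_norm_dexp_sub_le (m := m) (show 0 < min 1 (l / (4 * B)) by positivity)
  obtain ⟨ρ₃, hρ₃, H₃⟩ := exists_norm_exp_sub_one_lt (m := m) hr₆
  refine ⟨min ρ₂ ρ₃, lt_min hρ₂ hρ₃, fun h W hh hW hg => ?_⟩
  have hnW : ‖W‖ = 1 := CStarRing.norm_of_mem_unitary hW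
  have hg2 : ∀ i, ‖h i * star W - 1‖ < 1 / 2 := fun i => (hg i).trans_lt hδ₀
  set s : Set (Matrix m m ℂ) := ball (0 : Matrix m m ℂ) (min ρ₂ ρ₃) ∩ {X | Xᴴ = -X} with hsdef
  set f : Matrix m m ℂ → Matrix m m ℂ := fun X => Kmat h c (W * exp X) with hf
  set A : Matrix m m ℂ → (Matrix m m ℂ →L[ℝ] Matrix m m ℂ) := fun X₀ =>
    (ContinuousLinearMap.mul ℝ (Matrix m m ℂ) W).comp ((dexp X₀).restrictScalars ℝ) with hA
  set f' : Matrix m m ℂ → (Matrix m m ℂ →L[ℝ] Matrix m m ℂ) := fun X₀ => (emlD h c (W * exp X₀)).comp (A X₀) with hf'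
  set L : Matrix m m ℂ →L[ℝ] Matrix m m ℂ := (emlD h c W).comp (A 0) with hLdef
  -- points of the window: small exponent, base point `W e^X` close to `W`, hence guarded with small oscillation of `emlD`
  have hball : ∀ X ∈ s, X ∈ ball (0 : Matrix m m ℂ) ρ₂ ∧ ‖W * exp X - W‖ < r₆ := by
    intro X hX
    have hX' : ‖X‖ < min ρ₂ ρ₃ := by rw [hsdef] at hX; exact mem_ball_zero_iff.1 hX.1
    refine ⟨mem_ball_zero_iff.2 (hX'.trans_le (min_le_left _ _)), ?_⟩
    have h3 := H₃ X (hX'.trans_le (min_le_right _ _))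
    calc ‖W * exp X - W‖ = ‖W * (exp X - 1)‖ := by rw [mul_sub, mul_one]
      _ ≤ ‖W‖ * ‖exp X - 1‖ := norm_mul_le _ _
      _ < r₆ := by rw [hnW, one_mul]; exact h3
  have hguard : ∀ X ∈ s, (∀ i, ‖h i * star (W * exp X) - 1‖ < 1 / 2) ∧ ‖emlD h c (W * exp X) - emlD h c W‖ ≤ l / 8 := fun X hX =>
    H₆ h W _ hh hW hg (hball X hX).2
  -- differentiability on the window
  have hderiv : ∀ X ∈ s, HasFDerivWithinAt f (f' X) s X := fun X hX =>
    (hasFDerivAt_kmat_expChart h c W X fun i => ((hguard X hX).1 i).trans (by norm_num)).hasFDerivWithinAt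
  -- the floor of `L` on skew differences
  have hL : ∀ X ∈ s, ∀ Y ∈ s, l * ‖Y - X‖ ≤ ‖L (Y - X)‖ := by
    intro X hX Y hY
    have hskew : (Y - X)ᴴ = -(Y - X) := by
      have hX' : Xᴴ = -X := hX.2
      have hY' : Yᴴ = -Y := hY.2
      rw [Matrix.conjTranspose_sub, hX', hY']; abel
    have e : L (Y - X) = emlD h c W (W * (Y - X)) := by
      simp only [hLdef, hA, ContinuousLinearMap.comp_apply, ContinuousLinearMap.mul_apply', dexp_zero_restrictScalars,
        ContinuousLinearMap.id_apply]
    rw [e]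
    exact floor_op hh hW hg2 hc0 hc1.le hskew
  -- norms of the inner maps
  have hmulW : ‖ContinuousLinearMap.mul ℝ (Matrix m m ℂ) W‖ ≤ 1 := (ContinuousLinearMap.opNorm_mul_apply_le ℝ (Matrix m m ℂ) W).trans hnW.le
  have hnA : ∀ X₀ ∈ s, ‖A X₀‖ ≤ 2 ∧ ‖A X₀ - A 0‖ ≤ l / (4 * B) := by
    intro X₀ hX₀
    have hd := H₂ X₀ (hball X₀ hX₀).1
    have hd1 : ‖(dexp X₀).restrictScalars ℝ - (dexp (0 : Matrix m m ℂ)).restrictScalars ℝ‖ ≤ l / (4 * B) := hd.trans (min_le_right _ _)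
    have hd2 : ‖(dexp X₀).restrictScalars ℝ‖ ≤ 2 := by
      have h0 : ‖(dexp (0 : Matrix m m ℂ)).restrictScalars ℝ‖ ≤ 1 := by rw [dexp_zero_restrictScalars]; exact ContinuousLinearMap.norm_id_le
      have := norm_le_norm_add_norm_sub' ((dexp X₀).restrictScalars ℝ) ((dexp (0 : Matrix m m ℂ)).restrictScalars ℝ)
      linarith [hd.trans (min_le_left _ _)]
    constructor
    · calc ‖A X₀‖ ≤ ‖ContinuousLinearMap.mul ℝ (Matrix m m ℂ) W‖ * ‖(dexp X₀).restrictScalars ℝ‖ := ContinuousLinearMap.opNorm_comp_le _ _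
        _ ≤ 1 * 2 := by gcongr
        _ = 2 := by norm_num
    · have e : A X₀ - A 0 = (ContinuousLinearMap.mul ℝ (Matrix m m ℂ) W).comp
          ((dexp X₀).restrictScalars ℝ - (dexp (0 : Matrix m m ℂ)).restrictScalars ℝ) := by
        simp only [hA, ContinuousLinearMap.comp_sub]
      rw [e]
      calc ‖(ContinuousLinearMap.mul ℝ (Matrix m m ℂ) W).comp ((dexp X₀).restrictScalars ℝ - (dexp (0 : Matrix m m ℂ)).restrictScalars ℝ)‖
          ≤ ‖ContinuousLinearMap.mul ℝ (Matrix m m ℂ) W‖ * ‖(dexp X₀).restrictScalars ℝ - (dexp (0 : Matrix m m ℂ)).restrictScalars ℝ‖ :=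
            ContinuousLinearMap.opNorm_comp_le _ _
        _ ≤ 1 * (l / (4 * B)) := by gcongr
        _ = l / (4 * B) := one_mul _
  -- the oscillation `‖f′(X₀) − L‖ ≤ l∕2`
  have hosc : ∀ X₀ ∈ s, ‖f' X₀ - L‖ ≤ l / 2 := by
    intro X₀ hX₀
    obtain ⟨hA2, hAd⟩ := hnA X₀ hX₀
    have hE := (hguard X₀ hX₀).2
    have hE0 : ‖emlD h c W‖ ≤ B := hB h W hh hW hg
    have e : f' X₀ - L = (emlD h c (W * exp X₀) - emlD h c W).comp (A X₀) + (emlD h c W).comp (A X₀ - A 0) := by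
      simp only [hf', hLdef, ContinuousLinearMap.sub_comp, ContinuousLinearMap.comp_sub]; abel
    rw [e]
    calc ‖(emlD h c (W * exp X₀) - emlD h c W).comp (A X₀) + (emlD h c W).comp (A X₀ - A 0)‖
        ≤ ‖(emlD h c (W * exp X₀) - emlD h c W).comp (A X₀)‖ + ‖(emlD h c W).comp (A X₀ - A 0)‖ :=
          norm_add_le ((emlD h c (W * exp X₀) - emlD h c W).comp (A X₀)) ((emlD h c W).comp (A X₀ - A 0))
      _ ≤ ‖emlD h c (W * exp X₀) - emlD h c W‖ * ‖A X₀‖ + ‖emlD h c W‖ * ‖A X₀ - A 0‖ :=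
          add_le_add (ContinuousLinearMap.opNorm_comp_le _ _) (ContinuousLinearMap.opNorm_comp_le _ _)
      _ ≤ l / 8 * 2 + B * (l / (4 * B)) := by gcongr
      _ = l / 2 := by field_simp; ring
  -- conclude with the window lemmas of §2
  have hs : Convex ℝ s := convex_skewBall (m := m) (min ρ₂ ρ₃)
  refine ⟨injOn_of_norm_fderiv_sub_le_of_sub hs hderiv L hL hosc (by linarith), fun X hX Y hY => ?_⟩
  have h1 := mul_norm_sub_le_norm_sub_of_sub hs hderiv L hL hosc hX hY
  have e : (1 - ∑ i, c i) / (2 * Real.sqrt (Fintype.card m)) = l - l / 2 := by rw [hl]; field_simp; ring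
  rw [e]
  exact h1

end Main

end Summit.QuantumFields.YangMills.BalabanUVNodes.N08HaarCompatibilityGuardInjectivityWindows

end
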